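import Summits.QuantumFields.YangMills.Theorems.UnitScaleTiltHistoryTailOfPackageV3TopHaarPushforward
import HarnessLib

/-!
# UV3 ∕ R3 crux `HistoryTailL` (stmt-QuantumFields-19936) — THE TWO-ROW v3 FACES: `UnitScaleTilt.HistoryTailL` FROM THE GUARDED v3 (α) SOCKET AND
# ONE N08 LETTER (hTop ∕ the weak closure `hN08` ∕ the registered-letter hJ(v3)) — the polymer binder `π` discharged, because it is DATA

Helper seat `ym-ust-19936-w6` (gen 7).  KERNEL OBSERVATION: `AlphaInputsT3AC.PolymerT3 F` is a `structure` of four DATA fields (`Loc`, `Pterm`, `enl`, `treeLen`;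
[Balaban1985UV3] (24)–(25) p.262, (43) p.266 — the indexing of the interaction terms) with NO `Prop` field, and in the v3 faces neither the guarded socket `hpkg`
nor the N08 row (hJ(v3) ∕ hTop ∕ `hN08`) mentions `π` (v3 carries no `hMain`).  Hence w8's three-row v3 face
✓`UnitScaleTiltHistoryTailOfPackageV3MassEnvelope.historyTailL_of_packageV3_of_massEnvelope (hpkg)(π)(hJ)` holds at ANY polymer fields, in particular at the
EMPTY ones (no localisation domains, zero terms, identity enlargement, zero tree length) written inline below — so the honest residual statement of the 19936
supplier chain in v3 currency has TWO displayed rows: «`HistoryTailL` ⟸ hpkg-v3 ∧ hTop» (w8's ✓`UnitScaleTiltHistoryTailOfPackageV3TopHaarPushforward.historyTailL_of_packageV3_of_topHaarPushforward (hpkg)(π)(hTop)`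
at the empty `π`; inside it the v3 N08 junction ✓`AlphaInputsT3AC.OfV3At.hJ_of_topHaarPushforward`, FLAT in `K`), or «⟸ hpkg-v3 ∧ hTopB» (`blockAvg ℰp` spelled out), or
«⟸ hpkg-v3 ∧ `hN08`» (the weak-closure letter), or «⟸ hpkg-v3 ∧ hJ(v3)» (the registered letter).  This is NOT a vacuity: the faces are true for every `π`
because nothing in them depends on it; whatever (67)–(71) polymer content the construction needs lives inside the v3 socket's own rows.

HONEST: CONDITIONAL — faces; they do NOT prove `HistoryTailL`: hpkg-v3 (Theorem 2 p.272's package, guarded `1 < L`) and hTop ∕ `hN08` ∕ hJ(v3) (the Jacobian ∕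
Haar-compatibility of the K-fold `blockAvg ℰp`) are DISPLAYED hypotheses; rung R3 = SU(2) YM₃ on T³ — not d = 4, not infinite volume, not a mass gap.
-/

set_option autoImplicit false

noncomputable section

namespace Summit.QuantumFields.YangMills.Theorems.UnitScaleTiltHistoryTailOfPackageV3TopOnly

open MeasureTheory
open scoped ENNReal
open Literature.MathematicalPhysics.QuantumFieldTheory.Balaban1983to89
open Literature.MathematicalPhysics.QuantumFieldTheory.Balaban1983to89.T3ContinuumYM3Torus
open Literature.MathematicalPhysics.QuantumFieldTheory.Balaban1983to89.T4AvgSensitivity (iterFrom)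
open Literature.MathematicalPhysics.QuantumFieldTheory.Balaban1985CMP102
open Literature.MathematicalPhysics.QuantumFieldTheory.Balaban1985CMP102.Setting
open Summit.QuantumFields.Balaban3D.Carriers
open Summit.QuantumFields.Balaban3D.Proofs.Primitives
open Summit.QuantumFields.Balaban3D.Proofs.GroupModelLieC
open Literature.MathematicalPhysics.QuantumFieldTheory.Balaban1983to89.T3UnitLawDensityEML (ℰp)
open Summit.QuantumFields.YangMills.Theorems.UnitScaleTiltHistoryTailOfPackageV3MassEnvelope (historyTailL_of_packageV3_of_massEnvelope)
open Summit.QuantumFields.YangMills.Theorems.UnitScaleTiltHistoryTailOfPackageV3TopHaarPushforward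

/-- ★★★★ **TWO ROWS: `UnitScaleTilt.HistoryTailL` FROM THE GUARDED v3 (α) SOCKET AND THE REGISTERED LETTER hJ(v3)** — w8's three-row face at the EMPTY polymer
fields (inline: `Loc := ∅`, `Pterm := 0`, `enl := id`, `treeLen := 0`).  CONDITIONAL — a face. [cite: Balaban1985UV3, Thm 1 (5) p.256, (41) p.266, (47) p.267, (70)-(71) p.273] -/
theorem historyTailL_of_packageV3_of_massEnvelope₂
    (hpkg : ∀ L : ℕ, 1 < L → ∃ (𝔠 : AlphaConsts L (suGroupModel 2).N) (a₀ a₁ : ℝ),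
      (0 < a₀ ∧ 0 < a₁ ∧ 𝔠.B₃ * a₁ ≤ a₀) ∧ ∀ (F : T3Family) (hF : F.L = L), AlphaInputsT3AC.OfV3At F (hF ▸ 𝔠) a₀ a₁)
    (hJ : ∀ (F : T3Family) (𝔠 : AlphaConsts F.L (suGroupModel 2).N) (a₀ a₁ : ℝ) (h : AlphaInputsT3AC.OfV3At F 𝔠 a₀ a₁)
      (hc : 0 < a₀ ∧ 0 < a₁ ∧ 𝔠.B₃ * a₁ ≤ a₀) (γ : ℝ) (hγ : 0 < γ) (hγ1 : γ ≤ (min 𝔠.gamma0 1) ^ 2),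
      ∃ A₁ : ℝ, ∀ (K : ℕ) (r : Hist (F.P K) K),
        Hist.Admissible 𝔠.lane.carrier.M₁ (rcolOf (T3Scales F γ hγ (hγ1.trans (sq_min_one_le _ 𝔠.gamma0_pos)) K) 𝔠.lane.carrier) K r →
        r ≠ Hist.triv (F.P K) K →
        ∀ᵐ W ∂(fieldMeasure (F.P K) K (Matrix.specialUnitaryGroup (Fin 2) ℂ)),
          PinnedStep.massP 𝔠.lane (h.pkgAtV3 hc γ hγ hγ1 K).X K r W ≤ Real.exp A₁) :
    Summit.QuantumFields.YangMills.Theses.UnitScaleTilt.HistoryTailL :=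
  historyTailL_of_packageV3_of_massEnvelope hpkg (fun _ => ⟨fun _ _ _ _ => ∅, fun _ _ _ _ => 0, fun _ _ X => X, fun _ _ _ => 0⟩) hJ

/-- ★★★★ **TWO ROWS: `UnitScaleTilt.HistoryTailL` FROM THE GUARDED v3 (α) SOCKET AND hTop** (★★OWNER WORD 68's letter per family, w3's K-23-TOP ∀F binder
VERBATIM) — w8's ✓`historyTailL_of_packageV3_of_topHaarPushforward` at the empty polymer fields (inside: the v3 N08 junction ✓`OfV3At.hJ_of_topHaarPushforward`, FLAT in `K`);
no `π`, no `hMain`, no `hTriv`.  CONDITIONAL — a face; it does NOT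
prove `HistoryTailL`. [cite: Balaban1985UV3, Thm 1 (5) p.256, (41) p.266, (47) p.267, (70)-(71) p.273] -/
theorem historyTailL_of_packageV3_of_topHaarPushforward₂
    (hpkg : ∀ L : ℕ, 1 < L → ∃ (𝔠 : AlphaConsts L (suGroupModel 2).N) (a₀ a₁ : ℝ),
      (0 < a₀ ∧ 0 < a₁ ∧ 𝔠.B₃ * a₁ ≤ a₀) ∧ ∀ (F : T3Family) (hF : F.L = L), AlphaInputsT3AC.OfV3At F (hF ▸ 𝔠) a₀ a₁)
    (hTop : ∀ F : T3Family, ∃ c : ℝ, 0 ≤ c ∧ ∀ (K j n : ℕ), j + n = K →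
      (fieldMeasure (F.P K) j (Matrix.specialUnitaryGroup (Fin 2) ℂ)).map (iterFrom (avT3 F K) j n) ≤
        ENNReal.ofReal (Real.exp c) • fieldMeasure (F.P K) (j + n) (Matrix.specialUnitaryGroup (Fin 2) ℂ)) :
    Summit.QuantumFields.YangMills.Theses.UnitScaleTilt.HistoryTailL :=
  historyTailL_of_packageV3_of_topHaarPushforward hpkg (fun _ => ⟨fun _ _ _ _ => ∅, fun _ _ _ _ => 0, fun _ _ X => X, fun _ _ _ => 0⟩) hTop

/-- ★★★ **TWO ROWS: THE SAME WITH THE CRUX'S AVERAGING `blockAvg ℰp` SPELLED OUT** (hTopB, px8's letter) — w8's `…_of_topBlockAvgPushforward` at the empty polymer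
fields.  CONDITIONAL — a face. [cite: Balaban1985UV3, Thm 1 (5) p.256, (2) p.256, (41) p.266, (70)-(71) p.273] -/
theorem historyTailL_of_packageV3_of_topBlockAvgPushforward₂
    (hpkg : ∀ L : ℕ, 1 < L → ∃ (𝔠 : AlphaConsts L (suGroupModel 2).N) (a₀ a₁ : ℝ),
      (0 < a₀ ∧ 0 < a₁ ∧ 𝔠.B₃ * a₁ ≤ a₀) ∧ ∀ (F : T3Family) (hF : F.L = L), AlphaInputsT3AC.OfV3At F (hF ▸ 𝔠) a₀ a₁)
    (hTopB : ∀ F : T3Family, ∃ c : ℝ, 0 ≤ c ∧ ∀ (K j n : ℕ), j + n = K →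
      (fieldMeasure (F.P K) j (Matrix.specialUnitaryGroup (Fin 2) ℂ)).map
          (iterFrom (fun i => BlockAveraging.blockAvg (P := F.P K) (G := Matrix.specialUnitaryGroup (Fin 2) ℂ) (j := i) ℰp) j n) ≤
        ENNReal.ofReal (Real.exp c) • fieldMeasure (F.P K) (j + n) (Matrix.specialUnitaryGroup (Fin 2) ℂ)) :
    Summit.QuantumFields.YangMills.Theses.UnitScaleTilt.HistoryTailL :=
  historyTailL_of_packageV3_of_topBlockAvgPushforward hpkg (fun _ => ⟨fun _ _ _ _ => ∅, fun _ _ _ _ => 0, fun _ _ X => X, fun _ _ _ => 0⟩) hTopB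

/-- ★★★ **TWO ROWS: `UnitScaleTilt.HistoryTailL` FROM THE GUARDED v3 (α) SOCKET AND THE N08 WEAK-CLOSURE LETTER `hN08`** (per family, some `A₁ ≥ 0`; the
SAME letter that feeds the v1 face's hJ ∕ hTriv) — w8's `…_of_weakClosed_avT3` at the empty polymer fields.  CONDITIONAL — a face.
[cite: Balaban1985UV3, Thm 1 (5) p.256, (41) p.266, (47) p.267, (70)-(71) p.273] -/
theorem historyTailL_of_packageV3_of_weakClosed_avT3₂
    (hpkg : ∀ L : ℕ, 1 < L → ∃ (𝔠 : AlphaConsts L (suGroupModel 2).N) (a₀ a₁ : ℝ),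
      (0 < a₀ ∧ 0 < a₁ ∧ 𝔠.B₃ * a₁ ≤ a₀) ∧ ∀ (F : T3Family) (hF : F.L = L), AlphaInputsT3AC.OfV3At F (hF ▸ 𝔠) a₀ a₁)
    (hN08 : ∀ F : T3Family, ∃ A₁ : ℝ, 0 ≤ A₁ ∧ ∀ K : ℕ, ∃ ν : ∀ k, Measure (GaugeField (F.P K) k (Matrix.specialUnitaryGroup (Fin 2) ℂ)),
      (∀ k, k < K → (fieldMeasure (F.P K) k _ + ν k).map (avT3 F K k).avg ≤ fieldMeasure (F.P K) (k + 1) _ + ν (k + 1)) ∧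
      (∀ k, k ≤ K → ν k ≤ ENNReal.ofReal (Real.exp A₁ - 1) • fieldMeasure (F.P K) k _)) :
    Summit.QuantumFields.YangMills.Theses.UnitScaleTilt.HistoryTailL :=
  historyTailL_of_packageV3_of_weakClosed_avT3 hpkg (fun _ => ⟨fun _ _ _ _ => ∅, fun _ _ _ _ => 0, fun _ _ X => X, fun _ _ _ => 0⟩) hN08

end Summit.QuantumFields.YangMills.Theorems.UnitScaleTiltHistoryTailOfPackageV3TopOnly

end
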